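import Literature.AnabelianGeometry.EtaleTheta.SettingModelChiLevelKernels
import Literature.AnabelianGeometry.EtaleTheta.SettingModelChiConjCentre
import Literature.AnabelianGeometry.EtaleTheta.SettingModelPowHat
import HarnessLib

/-!
# The χ-twisted root model of [EtTh] §1 (R78 (B)) — `Δ_Θ(curveχ) ≅ Ẑ(χ)`: explicit χ-equivariant coordinates

Mochizuki, *The étale theta function …*, Publ. RIMS **45** (2009) [EtTh], §1, PRIMS PDF p. 12
[cite: MochizukiEtTh2009, §1 p.12]: "`(Ẑ(1) ≅) Δ_Θ`". Layer L2 of the abc-iut cell (seat abc-iut-L6-d6 gen 4;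
abc-iut-L2-lead gen 3 RULINGS #13 R100, file F1c-model/part 2 of the R78 «χ-twisted root model» cluster) over
abc-iut-w5-d249's F4 `SettingModelChiSemidirect.lean` (`curveχ p`: `Π^tp_X := Γ ⋊_χ G_{ℚ_p}`, `Π_X := F̂₂ ⋊_χ G_{ℚ_p}`),
abc-iut-L2-d1's `ThetaQuotientsOfCurve.lean`
(`CurveTheta.thetaKer/CurveTheta.ellKer/CurveTheta.GTheta/CurveTheta.toTheta/CurveTheta.thetaToEll/CurveTheta.augTheta` for any `TemperedCurve`), abc-iut-w5-d024's
`SettingModelPowHat.lean` (`powHat`) and this seat's `SettingModelThetaCentreZHat` / `SettingModelChiConjCentre`.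

CONTENT — the input «`Δ_Θ(modelχ) ≅ Ẑ(χ)`, continuously and χ-equivariantly» of the cluster's Kummer file F6
(abc-iut-w5-d171's `ThetaSetting.KummerCore.coeffHom`), at the curve `curveχ p` (the record `modelχ` of F5b takes its
theta layer from `CurveTheta (curveχ p)` verbatim):
* (the theta-quotient kernels of `curveχ` in level coordinates, `mem_thetaKerχ_iff` / `mem_ellKerχ_iff`, and the
  re-keyed `Normal` instances are abc-iut-L2-d1's `SettingModelChiLevelKernels.lean`, imported);
* `cGfpχ`, `cThetaχ` — the continuous homomorphisms `t ↦ (c^t, 0) ∈ Γ` and its image in `(Π^tp_X)^Θ`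
  (`c^t := powHat (η⁅a,b⁆) t`);
* `cThetaχ_mem_ker`, `cThetaχ_injective`, `exists_cThetaχ_eq_of_mem_ker` — `cThetaχ` is a BIJECTION onto
  `Δ_Θ = Ker((Π^tp_X)^Θ ↠ (Π^tp_X)^ell)`;
* **`conj_cThetaχ`** — `g · c^t · g⁻¹ = c^{χ(aug g)·t}` in `(Π^tp_X)^Θ`: the conjugation action of `(Π^tp_X)^Θ` on
  `Δ_Θ` is the cyclotomic character through `augTheta`;
* `deltaThetaCoordχ : Ẑ →* Δ_Θ(curveχ)` (cod-restricted), `continuous_deltaThetaCoordχ`, `bijective_deltaThetaCoordχ`,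
  **`deltaThetaCoordχ_chi : deltaThetaCoordχ (χ(CurveTheta.augTheta g) t) = MulAut.conjNormal g (deltaThetaCoordχ t)`** — the
  exact shape of `KummerCore.coeffHom_smul` after composing with abc-iut-w5-d091's `cycloZHat : Λ(ℚ̄_pˣ) ≃* Ẑ`
  (which DEFINES `χ`, so the composite is tautologically Galois-equivariant).

SEMI-SYNTHETIC MODEL («split-Tate» stage 1: the deck direction is fixed by the twist); class (b) construction over
the frozen interface (three small definitions, no instance, no interface clause touched); consistency evidence only;
nothing of [EtTh] is asserted; no side is taken on [IUTchIII] Cor. 3.12.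
-/

noncomputable section

open Topology

namespace Literature.AnabelianGeometry.EtaleTheta.SettingModel

open Literature.AnabelianGeometry.SemiGraphs
open Function
open scoped commutatorElement

variable (p : ℕ) [Fact p.Prime]

/-! ### The coordinate `t ↦ c^t` into `Γ`, `Π^tp_X` and `(Π^tp_X)^Θ` -/

/-- `c^t := powHat (η⁅a,b⁆) t` satisfies the `cPow` specification `ι 1 ↦ η⁅a,b⁆`. [cite: MochizukiEtTh2009, §1 p.12] -/
theorem powHat_commutator_spec :
    powHat (eta ⁅FreeGroup.of (0 : Fin 2), FreeGroup.of 1⁆) (iotaZ (Multiplicative.ofAdd 1)) =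
      eta ⁅FreeGroup.of (0 : Fin 2), FreeGroup.of 1⁆ :=
  powHat_iotaZ_one _

/-- **`c^· : Ẑ → Γ`**, `t ↦ (c^t, 0)` (`ê(c^t) = 1`), a continuous homomorphism. [cite: MochizukiEtTh2009, §1 p.12] -/
def cGfpχ : ZH →ₜ* Gfp where
  toFun t := ⟨(powHat (eta ⁅FreeGroup.of (0 : Fin 2), FreeGroup.of 1⁆) t, 1),
    cPow_mk_mem_Gfp _ powHat_commutator_spec t⟩
  map_one' := by ext <;> simp
  map_mul' s t := by ext <;> simp
  continuous_toFun := by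
    apply Continuous.subtype_mk
    exact (powHat _).continuous.prodMk continuous_const

/-- [cite: MochizukiEtTh2009, §1 p.12] -/
@[simp] theorem coe_cGfpχ (t : ZH) :
    ((cGfpχ t : Gfp) : F₂hatT × Multiplicative ℤ) = (powHat (eta ⁅FreeGroup.of (0 : Fin 2), FreeGroup.of 1⁆) t, 1) :=
  rfl

/-- [cite: MochizukiEtTh2009, §1 p.12] -/
@[simp] theorem gfpFst_cGfpχ (t : ZH) :
    gfpFst (cGfpχ t) = powHat (eta ⁅FreeGroup.of (0 : Fin 2), FreeGroup.of 1⁆) t := rfl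

/-- **`c^· : Ẑ → (Π^tp_X)^Θ`**, the image of `t ↦ inl(c^t, 0)` in the theta quotient — continuous.
[cite: MochizukiEtTh2009, §1 p.12] -/
def cThetaχ : ZH →ₜ* CurveTheta.GTheta (curveχ p) where
  toMonoidHom := ((CurveTheta.toTheta (curveχ p)).comp (SemidirectProduct.inl : Gfp →* PiTpχ p)).comp cGfpχ.toMonoidHom
  continuous_toFun :=
    (CurveTheta.continuous_toTheta (curveχ p)).comp ((continuous_inlχ p).comp cGfpχ.continuous)

/-- [cite: MochizukiEtTh2009, §1 p.12] -/
theorem cThetaχ_apply (t : ZH) :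
    cThetaχ p t = CurveTheta.toTheta (curveχ p) (SemidirectProduct.inl (cGfpχ t)) := rfl

/-- `c^t ∈ Δ_Θ = Ker((Π^tp_X)^Θ ↠ (Π^tp_X)^ell)`. [cite: MochizukiEtTh2009, §1 p.12] -/
theorem cThetaχ_mem_ker (t : ZH) : cThetaχ p t ∈ (CurveTheta.thetaToEll (curveχ p)).ker := by
  rw [cThetaχ_apply, CurveTheta.mk_mem_ker_thetaToEll_iff, mem_ellKerχ_iff]
  refine ⟨fun N => ?_, SemidirectProduct.right_inl _⟩
  rw [SemidirectProduct.left_inl, gfpFst_cGfpχ, hHat_apply_of_cPowSpec _ powHat_commutator_spec]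
  exact ⟨rfl, rfl⟩

/-- Two elements of `Π^tp_X` with trivial `G`-component and `F̂₂`-components congruent modulo `[[F̂₂,F̂₂],F̂₂]⁻` have
the same image in `(Π^tp_X)^Θ`. [cite: MochizukiEtTh2009, §1 p.12] -/
theorem toTheta_eq_of_right_eq_one (x y : PiTpχ p) (hx : x.right = 1) (hy : y.right = 1)
    (h : gfpFst x.left * (gfpFst y.left)⁻¹ ∈
      (⁅⁅(⊤ : Subgroup F₂hatT), (⊤ : Subgroup F₂hatT)⁆, (⊤ : Subgroup F₂hatT)⁆).topologicalClosure) :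
    CurveTheta.toTheta (curveχ p) x = CurveTheta.toTheta (curveχ p) y := by
  rw [CurveTheta.toTheta, QuotientGroup.mk'_apply, QuotientGroup.mk'_apply, QuotientGroup.eq_iff_div_mem, mem_thetaKerχ_iff]
  have hr : (x / y).right = 1 := by
    simp only [div_eq_mul_inv, SemidirectProduct.mul_right, SemidirectProduct.inv_right, hx, hy, inv_one, mul_one]
  refine ⟨fun N => ?_, hr⟩
  have hl : gfpFst (x / y).left = gfpFst x.left * (gfpFst y.left)⁻¹ := by
    simp only [div_eq_mul_inv, SemidirectProduct.mul_left, SemidirectProduct.inv_left, hx, hy, inv_one, map_one,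
      MulAut.one_apply, map_mul, map_inv]
  rw [hl]
  exact (mem_closure_commutator₃_iff_forall_hHat _).mp h N

/-- **`cThetaχ` is injective** (injectivity of the `Ẑ`-coordinate on the theta centre).
[cite: MochizukiEtTh2009, §1 p.12] -/
theorem cThetaχ_injective : Injective (cThetaχ p) := by
  intro t t' h
  rw [cThetaχ_apply, cThetaχ_apply, CurveTheta.toTheta, QuotientGroup.mk'_apply, QuotientGroup.mk'_apply,
    QuotientGroup.eq_iff_div_mem, mem_thetaKerχ_iff] at h
  obtain ⟨h1, -⟩ := h
  have hl : gfpFst ((SemidirectProduct.inl (cGfpχ t) : PiTpχ p) / SemidirectProduct.inl (cGfpχ t')).left =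
      powHat (eta ⁅FreeGroup.of (0 : Fin 2), FreeGroup.of 1⁆) t *
        (powHat (eta ⁅FreeGroup.of (0 : Fin 2), FreeGroup.of 1⁆) t')⁻¹ := by
    rw [div_eq_mul_inv, ← map_inv, ← map_mul, SemidirectProduct.left_inl, map_mul, map_inv, gfpFst_cGfpχ,
      gfpFst_cGfpχ]
  have hmem : powHat (eta ⁅FreeGroup.of (0 : Fin 2), FreeGroup.of 1⁆) (t * t'⁻¹) ∈
      (⁅⁅(⊤ : Subgroup F₂hatT), (⊤ : Subgroup F₂hatT)⁆, (⊤ : Subgroup F₂hatT)⁆).topologicalClosure := by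
    rw [map_mul, map_inv, ← hl, mem_closure_commutator₃_iff_forall_hHat]
    exact h1
  have := eq_one_of_cPow_mem_closure₃ _ powHat_commutator_spec hmem
  rwa [mul_inv_eq_one] at this

/-- **`cThetaχ` maps ONTO `Δ_Θ`**: every element of `Ker((Π^tp_X)^Θ ↠ (Π^tp_X)^ell)` is some `c^t`.
[cite: MochizukiEtTh2009, §1 p.12] -/
theorem exists_cThetaχ_eq_of_mem_ker {d : CurveTheta.GTheta (curveχ p)} (hd : d ∈ (CurveTheta.thetaToEll (curveχ p)).ker) :
    ∃ t : ZH, cThetaχ p t = d := by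
  obtain ⟨g, rfl⟩ := QuotientGroup.mk_surjective d
  have hg : g ∈ CurveTheta.ellKer (curveχ p) := (CurveTheta.mk_mem_ker_thetaToEll_iff (curveχ p) g).mp hd
  obtain ⟨hxy, hr⟩ := (mem_ellKerχ_iff p g).mp hg
  have hcl : gfpFst g.left ∈ (⁅(⊤ : Subgroup F₂hatT), (⊤ : Subgroup F₂hatT)⁆).topologicalClosure :=
    (mem_closure_commutator₂_iff_forall_hHat _).mpr hxy
  obtain ⟨t, ht, -⟩ := exists_mul_inv_cPow_mem_closure₃ _ powHat_commutator_spec hcl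
  refine ⟨t, ?_⟩
  rw [cThetaχ_apply]
  symm
  exact toTheta_eq_of_right_eq_one p g _ hr (SemidirectProduct.right_inl _) (by simpa using ht)

/-- **Conjugation on `Δ_Θ` is the cyclotomic character**: `g · c^t · g⁻¹ = c^{χ(aug^Θ g)·t}` in `(Π^tp_X)^Θ` for
every `g ∈ (Π^tp_X)^Θ` — the geometric part acts trivially, the Galois part through `χ`.
[cite: MochizukiEtTh2009, §1 p.12] -/
theorem conj_cThetaχ (g : CurveTheta.GTheta (curveχ p)) (t : ZH) :
    g * cThetaχ p t * g⁻¹ = cThetaχ p (chi p (CurveTheta.augTheta (curveχ p) g) t) := by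
  obtain ⟨x, rfl⟩ := QuotientGroup.mk_surjective g
  have haug : CurveTheta.augTheta (curveχ p) (QuotientGroup.mk x : CurveTheta.GTheta (curveχ p)) = x.right := by
    change CurveTheta.augTheta (curveχ p) (CurveTheta.toTheta (curveχ p) x) = _
    rw [CurveTheta.augTheta_toTheta]
    rfl
  rw [haug, cThetaχ_apply, cThetaχ_apply, CurveTheta.toTheta, QuotientGroup.mk'_apply, QuotientGroup.mk'_apply,
    ← QuotientGroup.mk_mul, ← QuotientGroup.mk_inv, ← QuotientGroup.mk_mul]
  change CurveTheta.toTheta (curveχ p) _ = CurveTheta.toTheta (curveχ p) _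
  refine toTheta_eq_of_right_eq_one p _ _ (right_conj_inl p x _) (SemidirectProduct.right_inl _) ?_
  rw [SemidirectProduct.left_inl, gfpFst_cGfpχ]
  exact conj_inl_cPow_mul_inv_mem_closure₃ p _ powHat_commutator_spec x t

/-! ### Packaged: `Ẑ ≅ Δ_Θ(curveχ)`, continuous, χ-equivariant -/

/-- **`Ẑ → Δ_Θ(curveχ)`**, `t ↦ c^t`, cod-restricted to `Δ_Θ = Ker((Π^tp_X)^Θ ↠ (Π^tp_X)^ell)`.
[cite: MochizukiEtTh2009, §1 p.12] -/
def deltaThetaCoordχ : ZH →* (CurveTheta.thetaToEll (curveχ p)).ker :=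
  (cThetaχ p).toMonoidHom.codRestrict _ (cThetaχ_mem_ker p)

/-- [cite: MochizukiEtTh2009, §1 p.12] -/
@[simp] theorem coe_deltaThetaCoordχ (t : ZH) : ((deltaThetaCoordχ p t : (CurveTheta.thetaToEll (curveχ p)).ker) : CurveTheta.GTheta (curveχ p)) =
    cThetaχ p t := rfl

/-- `t ↦ c^t : Ẑ → Δ_Θ` is continuous. [cite: MochizukiEtTh2009, §1 p.12] -/
theorem continuous_deltaThetaCoordχ : Continuous (deltaThetaCoordχ p) :=
  (cThetaχ p).continuous.subtype_mk _

/-- **`t ↦ c^t : Ẑ → Δ_Θ(curveχ)` is bijective** (`Δ_Θ ≅ Ẑ` explicitly). [cite: MochizukiEtTh2009, §1 p.12] -/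
theorem bijective_deltaThetaCoordχ : Bijective (deltaThetaCoordχ p) := by
  constructor
  · intro t t' h
    exact cThetaχ_injective p (congrArg Subtype.val h)
  · rintro ⟨d, hd⟩
    obtain ⟨t, ht⟩ := exists_cThetaχ_eq_of_mem_ker p hd
    exact ⟨t, Subtype.ext ht⟩

/-- **χ-equivariance** in the shape of `ThetaSetting.KummerCore.coeffHom_smul`: for `g ∈ (Π^tp_X)^Θ`,
`c^{χ(aug^Θ g)·t} = g · c^t · g⁻¹ = MulAut.conjNormal g (c^t)` — `Δ_Θ(curveχ) ≅ Ẑ(χ) = Ẑ(1)`.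
[cite: MochizukiEtTh2009, §1 p.12] -/
theorem deltaThetaCoordχ_chi (g : CurveTheta.GTheta (curveχ p)) (t : ZH) :
    deltaThetaCoordχ p (chi p (CurveTheta.augTheta (curveχ p) g) t) = MulAut.conjNormal g (deltaThetaCoordχ p t) := by
  apply Subtype.ext
  rw [MulAut.conjNormal_apply, coe_deltaThetaCoordχ, coe_deltaThetaCoordχ, conj_cThetaχ]

/-- The level coordinates of a representative: if `toTheta x = c^t` then `ĥ_N(x) = (0, 0, t mod N)` for every `N`.
[cite: MochizukiEtTh2009, §1 p.12] -/
theorem hHat_eq_of_toTheta_eq_cThetaχ {x : PiTpχ p} {t : ZH} (h : CurveTheta.toTheta (curveχ p) x = cThetaχ p t) (N : ℕ+) :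
    hHat N (gfpFst x.left) = ⟨0, 0, Multiplicative.toAdd (modN N t)⟩ := by
  rw [cThetaχ_apply, CurveTheta.toTheta, QuotientGroup.mk'_apply, QuotientGroup.mk'_apply, QuotientGroup.eq_iff_div_mem,
    mem_thetaKerχ_iff] at h
  obtain ⟨h1, hr⟩ := h
  have hxr : x.right = 1 := by
    have := hr
    simp only [div_eq_mul_inv, SemidirectProduct.mul_right, SemidirectProduct.inv_right,
      SemidirectProduct.right_inl, inv_one, mul_one] at this
    exact this
  have hl : gfpFst (x / SemidirectProduct.inl (cGfpχ t)).left =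
      gfpFst x.left * (powHat (eta ⁅FreeGroup.of (0 : Fin 2), FreeGroup.of 1⁆) t)⁻¹ := by
    simp only [div_eq_mul_inv, SemidirectProduct.mul_left, SemidirectProduct.inv_left, hxr,
      SemidirectProduct.right_inl, inv_one, map_one, MulAut.one_apply, map_mul, map_inv,
      SemidirectProduct.left_inl, gfpFst_cGfpχ]
  have key := h1 N
  rw [hl, map_mul, map_inv, hHat_apply_of_cPowSpec _ powHat_commutator_spec, mul_inv_eq_one] at key
  exact key

end Literature.AnabelianGeometry.EtaleTheta.SettingModel

end
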